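import Mathlib
import Summits.KontsevichZagierPeriods.Zeta5Search.WellPoisedFaceZeta579
import HarnessLib.Audit
import HarnessLib

/-!
# The numerator-free face envelope closes EXACTLY the windows strictly inside Zudilin's theorem:
# it holds for every `q ≤ 11` and FAILS for every `q ≥ 12` — cell `pub-zeta5`, class `odd` (gen 7), target T4

HONEST FRAMING: systematic search; no irrationality claim unless certified.  A statement about the REACH OF A
METHOD (the crude envelope `C₀ < δ − φ⁺` of `WellPoisedFaceZeta57` / `WellPoisedFaceZeta579`), i.e. a negative
result about our own bookkeeping; nothing here is a candidate or an irrationality claim, and nothing here says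
that Proposition 5 applies anywhere.

Provenance: family-designer seat `pub-zeta5-fam-odd-g7` (planner role; staged under
`run/shared/lean/pub/pub-zeta5/lean/fam-odd/`; `families/odd/FAMILY.md` §5.11 / census R13) for VERBATIM filing
by the lane.  Not literature.  Source (PRINTED) for the objects: W. Zudilin, J. Théor. Nombres Bordeaux 16 (2004)
251–291 = arXiv:math/0206176, §8 [cite: Zudilin2004, §8: (8.6)–(8.9), Lemma 19, (8.13), Prop. 5]; dictionary
(`C0`, `delta`, `phiPlus`, `mOf`, `blockRate`, `FaceDirM M`, `q = M + 5`) as in `WellPoisedFaceZeta57`.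

## Results (complete proofs)
* `FaceDirM.flatFace M` = the face direction `(20; 0³, 4, 4, …, 4, 7)` (all middle tails equal to `η₄ = η₀/5`,
  top tail `0.35η₀` — the float arg-min shape at `M = 7`); `flatFace_C0 : C₀ = (M+1)·g(20,4) + g(20,7)`,
  `flatFace_delta : δ = 61 + 16M`, `flatFace_phiPlus : φ⁺ = 12 + 12M`; exact values `blockRate_twenty_four :
  g(20,4) = 32 log 2 − 12 log 3`, `blockRate_twenty_seven : g(20,7) = 13 log 13 − 6 log 2 − 6 log 3 − 7 log 7` and
  certified bounds `≥ 8.98`, `≥ 8.6` (`log_three_le`, `log_thirteen_ge`, `log_seven_le`, Mathlib's `log 2` digits).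
* **`FaceDirM.flatFace_envelope_fails` (`7 ≤ M`): `δ − φ⁺ < C₀` at the flat direction** (`49 + 4M < (M+1)·8.98 +
  8.6`; at `M = 7`: `77 < 80.45 ≤ C₀ = 80.95`), hence **`face_envelope_fails` (`7 ≤ M`, i.e. `q ≥ 12`):
  `¬ ∀ D, C₀ ≤ δ − φ⁺`** — no tangent bookkeeping whatsoever extends the face no-go beyond `q = 11`.
* **`FaceDirM.face_envelope_iff` : `(∀ D : FaceDirM M, C₀ < δ − φ⁺) ↔ M ≤ 6`** — with `face_noGo_le_six` of
  `WellPoisedFaceZeta579`: the envelope method decides Proposition 5 on the numerator-free face for EXACTLY the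
  boxes `q = 7, …, 11`, i.e. the windows `{ζ(5)}`, `{ζ(5),ζ(7)}`, `{ζ(5),ζ(7),ζ(9)}` that are still open; from
  `q = 12` on (Zudilin's window `{ζ(5),…,ζ(11)}` and wider) it is silent.
## What is NOT proved here
Whether Proposition 5 applies at some face direction for `q ≥ 12` (it needs `C₀ > δ − φ` with the TRUE saving
`φ ≤ φ⁺`; `C₀ > δ − φ⁺` does not give it — and Zudilin's own `q = 13` direction is interior, `η₁ = η₂ = η₃ = 27`);
the meaning of `C0` (boundary lemma) as in the imported files.
-/

noncomputable section

open Real Finset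

namespace Summit.KontsevichZagierPeriods.Zeta5Search

namespace WellPoisedFace

/-! ### 1. Certified logarithms and the two block rates of the flat direction -/

/-- `log 3 ≤ 1.1` (float `1.098612`): `3 ≤ Σ_{i<8} x^i/i!` at `x = 11/10`. -/
theorem log_three_le : log (3 : ℝ) ≤ 11 / 10 := by
  rw [Real.log_le_iff_le_exp (by norm_num)]
  have h := Real.sum_le_exp_of_nonneg (show (0 : ℝ) ≤ 11 / 10 by norm_num) 8
  norm_num [Finset.sum_range_succ, Nat.factorial] at h
  linarith

/-- `log 13 ≥ 4 log 2 − 3/13` (`log(13/16) ≥ 1 − 16/13`; float `2.5649 ≥ 2.5418`). -/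
theorem log_thirteen_ge : 4 * log 2 - 3 / 13 ≤ log (13 : ℝ) := by
  have h1 : log (13 : ℝ) = log ((2 : ℝ) ^ 4) + log (13 / 16) := by
    rw [← Real.log_mul (by norm_num) (by norm_num)]; norm_num
  have h2 := Real.one_sub_inv_le_log_of_pos (show (0 : ℝ) < 13 / 16 by norm_num)
  rw [h1, Real.log_pow]
  push_cast
  norm_num at h2 ⊢
  linarith

/-- `log 7 ≤ 3 log 2 − 1/8` (`log(8/7) ≥ 1 − 7/8`; float `1.9459 ≤ 1.9544`). -/
theorem log_seven_le : log (7 : ℝ) ≤ 3 * log 2 - 1 / 8 := by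
  have h1 : log ((2 : ℝ) ^ 3) = log 7 + log (8 / 7) := by
    rw [← Real.log_mul (by norm_num) (by norm_num)]; norm_num
  have h2 := Real.one_sub_inv_le_log_of_pos (show (0 : ℝ) < 8 / 7 by norm_num)
  rw [Real.log_pow] at h1
  push_cast at h1
  norm_num at h2
  linarith

/-- `g(20, 4) = 16 log 16 − 12 log 12 − 4 log 4 = 32 log 2 − 12 log 3`. -/
theorem blockRate_twenty_four : blockRate 20 4 = 32 * log 2 - 12 * log 3 := by
  have h16 : log (16 : ℝ) = 4 * log 2 := by
    rw [show (16 : ℝ) = 2 ^ 4 by norm_num, Real.log_pow]; push_cast; ring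
  have h12 : log (12 : ℝ) = 2 * log 2 + log 3 := by
    rw [show (12 : ℝ) = 2 ^ 2 * 3 by norm_num, Real.log_mul (by norm_num) (by norm_num), Real.log_pow]
    push_cast; ring
  have h4 : log (4 : ℝ) = 2 * log 2 := by
    rw [show (4 : ℝ) = 2 ^ 2 by norm_num, Real.log_pow]; push_cast; ring
  unfold blockRate
  norm_num
  rw [h16, h12, h4]
  ring

/-- `g(20, 7) = 13 log 13 − 6 log 6 − 7 log 7 = 13 log 13 − 6 log 2 − 6 log 3 − 7 log 7`. -/
theorem blockRate_twenty_seven : blockRate 20 7 = 13 * log 13 - 6 * log 2 - 6 * log 3 - 7 * log 7 := by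
  have h6 : log (6 : ℝ) = log 2 + log 3 := by
    rw [show (6 : ℝ) = 2 * 3 by norm_num, Real.log_mul (by norm_num) (by norm_num)]
  unfold blockRate
  norm_num
  rw [h6]
  ring

/-- `g(20, 4) ≥ 8.98` (float `8.99736`). -/
theorem blockRate_twenty_four_ge : (898 / 100 : ℝ) ≤ blockRate 20 4 := by
  rw [blockRate_twenty_four]
  have h2 := Real.log_two_gt_d9
  have h3 := log_three_le
  norm_num at h2 h3 ⊢
  linarith

/-- `g(20, 7) ≥ 8.6` (float `8.97241`; net `25 log 2 − 8.725 ≥ 8.6037` from the crude bounds on `log 13`, `log 7`). -/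
theorem blockRate_twenty_seven_ge : (86 / 10 : ℝ) ≤ blockRate 20 7 := by
  rw [blockRate_twenty_seven]
  have h2 := Real.log_two_gt_d9
  have h3 := log_three_le
  have h13 := log_thirteen_ge
  have h7 := log_seven_le
  norm_num at h2 h3 h13 h7 ⊢
  linarith

/-! ### 2. The flat direction and the failure of the envelope for `M ≥ 7` -/

namespace FaceDirM

variable {M : ℕ}

/-- The FLAT face direction `(20; 0³, 4, 4, …, 4, 7)` with `M` middle tails equal to the smallest one
(`a = mid_j = η₀/5`, `d = 0.35η₀`: the float arg-min shape of `(δ − φ⁺ − C₀)/η₀` at `M = 7`, value `−0.199`). -/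
def flatFace (M : ℕ) : FaceDirM M where
  η₀ := 20
  a := 4
  mid := fun _ => 4
  d := 7
  ha := by norm_num
  hlo := fun _ => le_rfl
  hhi := fun _ => by norm_num
  had := by norm_num
  hd := by norm_num

/-- `C₀(flat) = (M+1)·g(20,4) + g(20,7)`. -/
theorem flatFace_C0 (M : ℕ) : (flatFace M).C0 = ((M : ℝ) + 1) * blockRate 20 4 + blockRate 20 7 := by
  show blockRate 20 4 + ∑ _j : Fin M, blockRate 20 4 + blockRate 20 7 = _
  rw [Finset.sum_const, Finset.card_univ, Fintype.card_fin, nsmul_eq_mul]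
  ring

/-- `δ(flat) = 3·16 + 16M + 13` (`m(4) = max{12, 16}`, `m(7) = max{12, 13}`). -/
theorem flatFace_delta (M : ℕ) : (flatFace M).delta = 61 + 16 * (M : ℝ) := by
  have h4 : (flatFace M).mOf 4 = 16 := by simp only [mOf, flatFace]; norm_num
  have h7 : (flatFace M).mOf 7 = 13 := by simp only [mOf, flatFace]; norm_num
  show 3 * (flatFace M).mOf 4 + ∑ _j : Fin M, (flatFace M).mOf 4 + (flatFace M).mOf 7 = _
  rw [h4, h7, Finset.sum_const, Finset.card_univ, Fintype.card_fin, nsmul_eq_mul]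
  ring

/-- `φ⁺(flat) = 12 + 12M`. -/
theorem flatFace_phiPlus (M : ℕ) : (flatFace M).phiPlus = 12 + 12 * (M : ℝ) := by
  show ((20 : ℝ) - 2 * 4) + ∑ _j : Fin M, ((20 : ℝ) - 2 * 4) = _
  rw [Finset.sum_const, Finset.card_univ, Fintype.card_fin, nsmul_eq_mul]
  ring

/-- **At the flat direction the envelope inequality is REVERSED for every `M ≥ 7`:**
`δ − φ⁺ = 49 + 4M < (M+1)·8.98 + 8.6 ≤ C₀` (at `M = 7`: `77 < 80.45 ≤ 80.95`). -/
theorem flatFace_envelope_fails (hM : 7 ≤ M) :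
    (flatFace M).delta - (flatFace M).phiPlus < (flatFace M).C0 := by
  rw [flatFace_delta, flatFace_phiPlus, flatFace_C0]
  have h4 := blockRate_twenty_four_ge
  have h7 := blockRate_twenty_seven_ge
  have hM' : (7 : ℝ) ≤ M := by exact_mod_cast hM
  nlinarith [mul_nonneg (sub_nonneg.mpr hM') (show (0 : ℝ) ≤ blockRate 20 4 - 4 by linarith)]

/-- **SHARPNESS OF THE FACE ENVELOPE (PROVED): for every `M ≥ 7` (`q ≥ 12`) the crude envelope
`C₀ ≤ δ − φ⁺` FAILS somewhere on the numerator-free face** — so no tangent bookkeeping whatsoever extends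
`face_noGo` beyond `q = 11`; the windows `q ≥ 12` are Zudilin's theorem (`q = 13`) or wider anyway.  This says
nothing about Proposition 5 itself at `q ≥ 12` (`φ⁺ ≥ φ` is an upper bound: `C₀ > δ − φ⁺` does not give
`C₀ > δ − φ`). -/
theorem face_envelope_fails (hM : 7 ≤ M) : ¬ ∀ D : FaceDirM M, D.C0 ≤ D.delta - D.phiPlus :=
  fun h => absurd (h (flatFace M)) (not_le.mpr (flatFace_envelope_fails hM))

/-! ### 3. The dichotomy -/

/-- **THE ENVELOPE DICHOTOMY (PROVED).** The crude face envelope `C₀ < δ − φ⁺` holds at EVERY direction of the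
numerator-free face of the `q = M + 5` box if and only if `M ≤ 6` (`q ≤ 11`): `←` is `face_noGo_le_six`
(`WellPoisedFaceZeta579`, margin `η₀/25`), `→` is `face_envelope_fails`. -/
theorem face_envelope_iff : (∀ D : FaceDirM M, D.C0 < D.delta - D.phiPlus) ↔ M ≤ 6 := by
  constructor
  · intro h
    by_contra hM
    exact face_envelope_fails (by omega) fun D => (h D).le
  · intro hM D
    exact D.face_noGo_le_six hM D.phiPlus le_rfl

/-- In particular no uniform margin survives `q = 12`: `¬ ∃ c ≥ 0, ∀ D : FaceDirM M, C₀ + c·η₀ ≤ δ − φ⁺` for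
`M ≥ 7` (compare `face_gap_le_six`: `c = 1/25` works for all `M ≤ 6`). -/
theorem no_face_gap (hM : 7 ≤ M) : ¬ ∃ c : ℝ, 0 ≤ c ∧ ∀ D : FaceDirM M, D.C0 + c * D.η₀ ≤ D.delta - D.phiPlus := by
  rintro ⟨c, hc, h⟩
  apply face_envelope_fails hM
  intro D
  have h1 := h D
  have h2 : 0 ≤ c * D.η₀ := mul_nonneg hc D.η₀_pos.le
  linarith

end FaceDirM

end WellPoisedFace

end Summit.KontsevichZagierPeriods.Zeta5Search
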